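import Summits.ResolutionOfSingularities.ResolutionOfSingularities.Theorems.InductiveStep.Negative.AboveGraphLegKernel

/-!
# Crux `InductiveStep` (stmt-ResolutionOfSingularities-17233) — negative knowledge: weights ABOVE the
# graph of `trop(G)` are NOT off the tropical variety (the LEG of a tropical modification)

Route `ResolutionOfSingularities/TropicalLinks`, crux `InductiveStep` (≡ `SchonPlus`, Tevelev's schön-open
conjecture in characteristic `p`, principal-open Gröbner form), line `split`, stub `stub_sncClosureSchon`
(cdisprove seat, gen 2 / cycle 1).  The schön clause of `SchonAt` quantifies over ALL integer weights
`w = (w', w'') ∈ ℤ^N × ℤ^m` of the unit-graph re-embedding `I' = ⟨ι(I), y_j − ι(G_j)⟩ ⊆ k[ℤ^(N+m)]`.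
The landed brick `Theorems.tropicalLinks_inIdeal_eq_top_of_weight_lt` (p160703) disposes of the weights
strictly BELOW the graph of `trop(G_j)` (`w''_j < ⟨w', u⟩` for every exponent `u` of `G_j` ⇒ `in_w(I') = ⊤`,
clause vacuous).  This file refutes the MIRROR-IMAGE strengthening and records what happens instead:

* `inductiveStep_not_aboveGraph_vacuity` — **REFUTED**: "`w''_j > ⟨w', u⟩` for every exponent `u` of `G_j`
  ⇒ `in_w(I') = ⊤`" is FALSE, even under every guard of the crux (`p` prime, `k = k̄` of characteristic
  `p`, `I` prime, `G_j ∉ I`).  Witness: `p = 2`, `k = 𝔽̄₂`, `N = m = 1`, `I = ⊥` (`U = 𝔾_m`, `d = 1`),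
  `G₀ = x − 1`, `w = (0, 1)`: the weight of the new variable `z = y₀` exceeds the weight `0` of BOTH
  monomials of `G₀`, but `(0,1) ∈ Trop(U[G⁻¹])` — it is the tropicalisation of the valuation `ord_{x=1}`
  (`val(x − 1) = 1 > 0 = min(val x, val 1)`: CANCELLATION inside `G₀`), the leg that the tropical
  modification along `V(G₀) ∩ U = {1}` attaches to `Trop(U) = {0}`.
* `inductiveStep_leg_inIdeal_le_ker` (main lemma, any field `k`; part 1/2 = `AboveGraphLegKernel.lean`) — the route's inlined
  `in_w(I')` is contained in the kernel of every `k`-algebra map `k[x^±, z^±] → k[z^±]`, `x ↦ 1, z ↦ z`;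
  proof by the `(X − 1)`-adic order: each `f ∈ I'` dies under `x ↦ X, z ↦ X − 1` into `Frac k[X^±]`
  (`inductiveStep_leg_layer_sum_eq_zero`, `inductiveStep_leg_bottom_layer_sum_eq_zero`), so the bottom
  `w`-layer of `f` — which IS `in_w(f)` — has coefficient sum `0`, i.e. `in_w(f)` dies at `x = 1`.
* `inductiveStep_leg_inIdeal_ne_top` — hence `in_w(I') ≠ ⊤`: the schön clause at the leg is NOT vacuous;
* `inductiveStep_leg_sub_mem_inIdeal` — and `x − 1 ∈ in_w(I')` (initial form of the generator
  `z − x + 1`, whose term `z` is strictly heavier): so `⟨x − 1⟩ ≤ in_w(I') ≤ ker(x ↦ 1)`, i.e. (both ends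
  being the prime `⟨x − 1⟩` on paper) the degeneration at the leg is the torus translate `{1} × 𝔾_m` —
  nonempty, REGULAR, of dimension `1 = d`: the clause holds there, with content;
* `inductiveStep_leg_generator_notMem_inIdeal` — the generator `z − x + 1 ∈ I'` is NOT in `in_w(I')`
  (it maps to `z ≠ 0` under `x ↦ 1`): `in_w(I') ≠ I'`, and the displayed generators of `I'` are not a
  tropical basis at the leg; the recipe "`in_w(I') = ⟨ι in_{w'}(I), y_j − ι in_{w'}(G_j)⟩`" (here
  `= ⟨0, z − (x − 1)⟩ = I'`) FAILS at leg weights.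

CONSEQUENCE FOR PROVERS (of `stub_sncClosureSchon` / `SchonLowDim` / the crux).  After the two landed
vacuity bricks (below-graph: p160703; one-term initial form: p160862) the weights that remain are those
at which, for every `j`, the minimum of `{w''_j} ∪ {⟨w', u⟩ : u ∈ supp G_j}` is attained at least twice.
This set is NOT the graph `{w''_j = trop(G_j)(w')}`: it contains the LEGS `{w''_j > trop(G_j)(w')}` over
the locus where `in_{w'}(G_j)` has ≥ 2 terms, and legs DO meet `Trop(U[G⁻¹])` (this file).  Their
initial degenerations are governed by the vanishing of `in_{w'}(G_j)` on `in_{w'}(U)` (tropical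
modification: Trop of the graph of `G|_U` is the MODIFICATION of `Trop U` along `trop(G|_U)`, not the
graph of `trop G` — cf. Cueto–Markwig arXiv:1409.7430 for plane curves), and no formula in
`in_{w'}(I)`, `in_{w'}(G_j)` and `y_j` alone computes `in_w(I')` there.  In Luxton–Qu's proof of
schön-ness for the complement of an snc boundary plus generic sections (arXiv:0902.2009 §3) this is
exactly where the INTERSECTION strata `D_i ∩ E` of the boundary enter.

All statements are in the route's INLINED terms (no new definitions); `open scoped Classical` matches
the decidability instance recorded in the route's term (cf. `NotInductiveStepIff.lean`, trap T1), and the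
landed bridge `Theorems.tropicalLinks_weightInitialIdeal_eq_span` (p160703) to
`Literature…Tropical.weightInitialIdeal` takes the instance as an explicit argument.
-/

-- single-problem summit: the doubled namespace component `ResolutionOfSingularities` is forced
set_option linter.dupNamespace false

namespace Summit.ResolutionOfSingularities.ResolutionOfSingularities.Theorems.InductiveStep.Negative

open AddMonoidAlgebra Literature.AlgebraicGeometry.Tropical
open scoped Classical

/-- **Weights ABOVE the graph are NOT off the tropical variety**: for the data of
`inductiveStep_leg_inIdeal_le_ker` (`U = 𝔾_m`, `G₀ = x − 1`, `w = (0,1)`: the weight `1` of `z` is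
STRICTLY LARGER than the `w'`-weight `0` of BOTH monomials of `G₀`) the route's initial ideal
`in_w(I')` is NOT the whole ring — the schön clause at this weight is NOT vacuous (it holds, because
`k[x^±,z^±] ⧸ ⟨x − 1⟩ ≅ k[z^±]` is regular, but it has content). Contrast the landed brick
`tropicalLinks_inIdeal_eq_top_of_weight_lt` (weights strictly BELOW the graph ARE off `Trop`): it has no
mirror image. [folklore] -/
theorem inductiveStep_leg_inIdeal_ne_top (k : Type) [Field k] :
    Ideal.span ((fun f : AddMonoidAlgebra k (Fin (1 + 1) → ℤ) => AddMonoidAlgebra.ofCoeff (f.coeff.filter fun v => ∀ u ∈ f.coeff.support, ∑ i, (Fin.append (0 : Fin 1 → ℤ) (1 : Fin 1 → ℤ)) i * v i ≤ ∑ i, (Fin.append (0 : Fin 1 → ℤ) (1 : Fin 1 → ℤ)) i * u i)) '' (↑(Ideal.span ((fun f : AddMonoidAlgebra k (Fin 1 → ℤ) => (AddMonoidAlgebra.ofCoeff (f.coeff.mapDomain fun v => Fin.append v (0 : Fin 1 → ℤ)) : AddMonoidAlgebra k (Fin (1 + 1) → ℤ))) '' (↑(⊥ : Ideal (AddMonoidAlgebra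 k (Fin 1 → ℤ))) : Set (AddMonoidAlgebra k (Fin 1 → ℤ))) ∪ Set.range (fun j : Fin 1 => AddMonoidAlgebra.single (Fin.append (0 : Fin 1 → ℤ) (Pi.single j (1 : ℤ))) (1 : k) - AddMonoidAlgebra.ofCoeff ((AddMonoidAlgebra.single (1 : Fin 1 → ℤ) (1 : k) - 1 : AddMonoidAlgebra k (Fin 1 → ℤ)).coeff.mapDomain fun v => Fin.append v (0 : Fin 1 → ℤ))))) : Set (AddMonoidAlgebra k (Fin (1 + 1) → ℤ)))) ≠ ⊤ := by
  obtain ⟨Ψ, hΨ⟩ := inductiveStep_leg_exists_subst k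
  have hle := inductiveStep_leg_inIdeal_le_ker k Ψ hΨ
  intro htop
  have h1 : (1 : AddMonoidAlgebra k (Fin (1 + 1) → ℤ)) ∈ RingHom.ker Ψ.toRingHom :=
    hle (htop.symm ▸ Submodule.mem_top)
  rw [RingHom.mem_ker] at h1
  exact one_ne_zero ((map_one Ψ.toRingHom).symm.trans h1)

/-- **The degeneration at the leg is not `U[G⁻¹]` itself, and the generators are not their own
initial ideal there**: the generator `z − ι(x − 1) = z − x + 1` of `I'` does NOT lie in `in_w(I')`
(it maps to `z ≠ 0` under `x ↦ 1`), although `I' = ⟨z − x + 1⟩ ∋` it; so `in_w(I') ≠ I'` — the naive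
recipe "`in_w(I') = ⟨ι in_{w'}(I), y_j − ι in_{w'}(G_j)⟩`" (here `= ⟨0, z − (x − 1)⟩ = I'`) FAILS at leg
weights. [folklore] -/
theorem inductiveStep_leg_generator_notMem_inIdeal (k : Type) [Field k] :
    (AddMonoidAlgebra.single (Fin.append (0 : Fin 1 → ℤ) (Pi.single (0 : Fin 1) (1 : ℤ))) (1 : k) - AddMonoidAlgebra.ofCoeff ((AddMonoidAlgebra.single (1 : Fin 1 → ℤ) (1 : k) - 1 : AddMonoidAlgebra k (Fin 1 → ℤ)).coeff.mapDomain fun v => Fin.append v (0 : Fin 1 → ℤ)) : AddMonoidAlgebra k (Fin (1 + 1) → ℤ)) ∉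
    Ideal.span ((fun f : AddMonoidAlgebra k (Fin (1 + 1) → ℤ) => AddMonoidAlgebra.ofCoeff (f.coeff.filter fun v => ∀ u ∈ f.coeff.support, ∑ i, (Fin.append (0 : Fin 1 → ℤ) (1 : Fin 1 → ℤ)) i * v i ≤ ∑ i, (Fin.append (0 : Fin 1 → ℤ) (1 : Fin 1 → ℤ)) i * u i)) '' (↑(Ideal.span ((fun f : AddMonoidAlgebra k (Fin 1 → ℤ) => (AddMonoidAlgebra.ofCoeff (f.coeff.mapDomain fun v => Fin.append v (0 : Fin 1 → ℤ)) : AddMonoidAlgebra k (Fin (1 + 1) → ℤ))) '' (↑(⊥ : Ideal (AddMonoidAlgebra k (Fin 1 → ℤ))) : Set (AddMonoidAlgebra k (Fin 1 → ℤ))) ∪ Set.range (fun j : Fin 1 => AddMonoidAlgebra.single (Fin.append (0 : Fin 1 → ℤ) (Pi.single j (1 : ℤ))) (1 : k) - AddMonoidAlgebra.ofCoeff ((AddMonoidAlgebra.single (1 : Fin 1 → ℤ) (1 : k) - 1 : AddMonoidAlgebra k (Fin 1 → ℤ)).coeff.mapDomain fun v => Fin.append v (0 : Fin 1 → ℤ)))))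 : Set (AddMonoidAlgebra k (Fin (1 + 1) → ℤ)))) := by
  obtain ⟨Ψ, hΨ⟩ := inductiveStep_leg_exists_subst k
  have hle := inductiveStep_leg_inIdeal_le_ker k Ψ hΨ
  intro hmem
  have h1 := hle hmem
  rw [RingHom.mem_ker] at h1
  have hcoeff : (single (1 : Fin 1 → ℤ) (1 : k) - 1 : (AddMonoidAlgebra k (Fin 1 → ℤ))).coeff =
      Finsupp.single 1 1 - Finsupp.single 0 1 := rfl
  rw [hcoeff, Finsupp.mapDomain_sub, Finsupp.mapDomain_single, Finsupp.mapDomain_single] at h1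
  rw [show (AddMonoidAlgebra.ofCoeff (Finsupp.single (Fin.append (1 : Fin 1 → ℤ) (0 : Fin 1 → ℤ)) (1 : k) -
      Finsupp.single (Fin.append (0 : Fin 1 → ℤ) (0 : Fin 1 → ℤ)) (1 : k)) : AddMonoidAlgebra k (Fin (1 + 1) → ℤ)) =
      single (Fin.append (1 : Fin 1 → ℤ) (0 : Fin 1 → ℤ)) (1 : k) -
        single (Fin.append (0 : Fin 1 → ℤ) (0 : Fin 1 → ℤ)) (1 : k) from rfl] at h1
  simp only [AlgHom.toRingHom_eq_coe, RingHom.coe_coe, map_sub, hΨ, Fin.append_right,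
    Pi.zero_apply] at h1
  -- `h1 : z − (x⁰ − x⁰) = 0` in `k[z^±]`, i.e. `z = 0`: absurd
  rw [sub_self, sub_zero, single_eq_zero] at h1
  exact one_ne_zero h1

/-- **REFUTED NATURAL STRENGTHENING (mirror image of the landed off-tropical brick).** It is NOT true
that, for the route's re-embedding `I' = ⟨ι(I), y_j − ι(G_j)⟩` (any prime `p`, algebraically closed `k`
of characteristic `p`, prime `I`, units `G_j ∉ I`), a weight `w` whose `y_j`-component is STRICTLY
LARGER than the `w'`-weight of every monomial of `G_j` has `in_w(I') = ⊤`: above the graph of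
`trop(G_j)` there are the LEGS of the tropical modification along `V(G_j) ∩ U` (cancellation in
`G_j`), on which the schön clause of `SchonAt` has genuine content. Witness: `p = 2`, `k = 𝔽̄₂`,
`U = 𝔾_m`, `G₀ = x − 1`, `w = (0, 1)` (`inductiveStep_leg_inIdeal_ne_top`). Consequence for provers
of `InductiveStep` / `stub_sncClosureSchon`: the schön clause does NOT reduce to the weights ON the
graph `w_y = trop(G)(w')` plus vacuity elsewhere; the legs `{w_y > trop(G)(w')} ∩ Trop(U[G⁻¹])` must be
treated (their degenerations are those of `in_{w'}(U) ∩ {in_{w'} G_j = 0}`-type data, not `⊤`).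
[folklore] -/
theorem inductiveStep_not_aboveGraph_vacuity :
    ¬ ∀ (p : ℕ), p.Prime → ∀ (k : Type) [Field k] [CharP k p] [IsAlgClosed k] (N m : ℕ)
      (I : Ideal (AddMonoidAlgebra k (Fin N → ℤ))), I.IsPrime →
      ∀ (G : Fin m → AddMonoidAlgebra k (Fin N → ℤ)), (∀ j, G j ∉ I) →
      ∀ (w : Fin (N + m) → ℤ) (j : Fin m),
      (∀ u ∈ (G j).coeff.support, ∑ i, w (Fin.castAdd m i) * u i < w (Fin.natAdd N j)) →
      Ideal.span ((fun f : AddMonoidAlgebra k (Fin (N + m) → ℤ) => AddMonoidAlgebra.ofCoeff (f.coeff.filter fun v => ∀ u ∈ f.coeff.support, ∑ i, w i * v i ≤ ∑ i, w i * u i)) '' (↑(Ideal.span ((fun f : AddMonoidAlgebra k (Fin N → ℤ) => (AddMonoidAlgebra.ofCoeff (f.coeff.mapDomain fun v => Fin.append v (0 : Fin m → ℤ)) : AddMonoidAlgebra k (Fin (N + m) → ℤ))) '' (↑I : Set (AddMonoidAlgebra k (Fin N → ℤ))) ∪ Set.range (fun j : Fin m => AddMonoidAlgebra.single (Fin.append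 (0 : Fin N → ℤ) (Pi.single j (1 : ℤ))) (1 : k) - AddMonoidAlgebra.ofCoeff ((G j).coeff.mapDomain fun v => Fin.append v (0 : Fin m → ℤ))))) : Set (AddMonoidAlgebra k (Fin (N + m) → ℤ)))) = ⊤ := by
  intro h
  haveI : Fact (Nat.Prime 2) := ⟨Nat.prime_two⟩
  have hguard : ∀ j : Fin 1, (fun _ : Fin 1 => (AddMonoidAlgebra.single (1 : Fin 1 → ℤ) (1 : AlgebraicClosure (ZMod 2)) - 1 :
      AddMonoidAlgebra (AlgebraicClosure (ZMod 2)) (Fin 1 → ℤ))) j ∉ (⊥ : Ideal (AddMonoidAlgebra (AlgebraicClosure (ZMod 2)) (Fin 1 → ℤ))) := by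
    intro j hj
    rw [Ideal.mem_bot, sub_eq_zero] at hj
    have h2 := congrArg (fun g : AddMonoidAlgebra (AlgebraicClosure (ZMod 2)) (Fin 1 → ℤ) => g.coeff (1 : Fin 1 → ℤ)) hj
    have h10 : (1 : Fin 1 → ℤ) ≠ 0 := fun h => one_ne_zero (congrFun h 0)
    simp only [one_def, coeff_single, Finsupp.single_eq_same] at h2
    rw [Finsupp.single_eq_of_ne h10] at h2
    exact one_ne_zero h2
  have hlt : ∀ u ∈ ((fun _ : Fin 1 => (AddMonoidAlgebra.single (1 : Fin 1 → ℤ) (1 : AlgebraicClosure (ZMod 2)) - 1 :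
      AddMonoidAlgebra (AlgebraicClosure (ZMod 2)) (Fin 1 → ℤ))) 0).coeff.support,
      ∑ i, (Fin.append (0 : Fin 1 → ℤ) (1 : Fin 1 → ℤ)) (Fin.castAdd 1 i) * u i <
        (Fin.append (0 : Fin 1 → ℤ) (1 : Fin 1 → ℤ)) (Fin.natAdd 1 0) := by
    intro u _
    simp only [Fin.append_left, Fin.append_right, Pi.zero_apply, Pi.one_apply, zero_mul,
      Finset.sum_const_zero]
    exact zero_lt_one
  exact inductiveStep_leg_inIdeal_ne_top (AlgebraicClosure (ZMod 2))
    (h 2 Nat.prime_two (AlgebraicClosure (ZMod 2)) 1 1 ⊥ Ideal.isPrime_bot _ hguard _ 0 hlt)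

/-- **… but `x − 1 ∈ in_w(I')`**: the initial form of the generator `z − x + 1` at `w = (0,1)` is its
bottom layer `1 − x` (the term `z` is strictly heavier), so `⟨x − 1⟩ ≤ in_w(I') ≤ ker(x ↦ 1)`: the
degeneration at the leg is (supported on) the torus translate `{x = 1} = {1} × 𝔾_m` — nonempty,
regular, of the dimension `1 = d` of `U`, as a component of `Trop` of a curve must be. [folklore] -/
theorem inductiveStep_leg_sub_mem_inIdeal (k : Type) [Field k] :
    (AddMonoidAlgebra.single (Fin.append (1 : Fin 1 → ℤ) (0 : Fin 1 → ℤ)) (1 : k) -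
        AddMonoidAlgebra.single (Fin.append (0 : Fin 1 → ℤ) (0 : Fin 1 → ℤ)) (1 : k) :
      AddMonoidAlgebra k (Fin (1 + 1) → ℤ)) ∈
    Ideal.span ((fun f : AddMonoidAlgebra k (Fin (1 + 1) → ℤ) => AddMonoidAlgebra.ofCoeff (f.coeff.filter fun v => ∀ u ∈ f.coeff.support, ∑ i, (Fin.append (0 : Fin 1 → ℤ) (1 : Fin 1 → ℤ)) i * v i ≤ ∑ i, (Fin.append (0 : Fin 1 → ℤ) (1 : Fin 1 → ℤ)) i * u i)) '' (↑(Ideal.span ((fun f : AddMonoidAlgebra k (Fin 1 → ℤ) => (AddMonoidAlgebra.ofCoeff (f.coeff.mapDomain fun v => Fin.append v (0 : Fin 1 → ℤ)) : AddMonoidAlgebra k (Fin (1 + 1) → ℤ))) '' (↑(⊥ : Ideal (AddMonoidAlgebra k (Fin 1 → ℤ))) : Set (AddMonoidAlgebra k (Fin 1 → ℤ))) ∪ Set.range (fun j : Fin 1 => AddMonoidAlgebra.single (Fin.append (0 : Fin 1 → ℤ) (Pi.single j (1 : ℤ))) (1 : k) - AddMonoidAlgebra.ofCoeff ((AddMonoidAlgebra.single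 (1 : Fin 1 → ℤ) (1 : k) - 1 : AddMonoidAlgebra k (Fin 1 → ℤ)).coeff.mapDomain fun v => Fin.append v (0 : Fin 1 → ℤ))))) : Set (AddMonoidAlgebra k (Fin (1 + 1) → ℤ)))) := by
  generalize hT : ((fun f : AddMonoidAlgebra k (Fin 1 → ℤ) => (AddMonoidAlgebra.ofCoeff (f.coeff.mapDomain fun v => Fin.append v (0 : Fin 1 → ℤ)) : AddMonoidAlgebra k (Fin (1 + 1) → ℤ))) '' (↑(⊥ : Ideal (AddMonoidAlgebra k (Fin 1 → ℤ))) : Set (AddMonoidAlgebra k (Fin 1 → ℤ))) ∪ Set.range (fun j : Fin 1 => AddMonoidAlgebra.single (Fin.append (0 : Fin 1 → ℤ) (Pi.single j (1 : ℤ))) (1 : k) - AddMonoidAlgebra.ofCoeff ((AddMonoidAlgebra.single (1 : Fin 1 → ℤ) (1 : k) - 1 : AddMonoidAlgebra k (Fin 1 → ℤ)).coeff.mapDomain fun v => Fin.append v (0 : Fin 1 → ℤ)))) = T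
  generalize hw : (Fin.append (0 : Fin 1 → ℤ) (1 : Fin 1 → ℤ)) = w
  refine (Eq.le (tropicalLinks_weightInitialIdeal_eq_span w (Ideal.span T) _)) ?_
  -- names for the three exponents `ez = (0,1)`, `ex = (1,0)`, `e0 = (0,0)` and the generator `g`
  set ez : Fin (1 + 1) → ℤ := Fin.append (0 : Fin 1 → ℤ) (Pi.single (0 : Fin 1) (1 : ℤ)) with hez
  set ex : Fin (1 + 1) → ℤ := Fin.append (1 : Fin 1 → ℤ) (0 : Fin 1 → ℤ) with hex
  set e0 : Fin (1 + 1) → ℤ := Fin.append (0 : Fin 1 → ℤ) (0 : Fin 1 → ℤ) with he0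
  have hg_mem : (single ez (1 : k) - (single ex (1 : k) - single e0 (1 : k)) :
      AddMonoidAlgebra k (Fin (1 + 1) → ℤ)) ∈ Ideal.span T := by
    refine Ideal.subset_span ?_
    rw [← hT]
    refine Or.inr ⟨0, ?_⟩
    have hcoeff : (single (1 : Fin 1 → ℤ) (1 : k) - 1 : (AddMonoidAlgebra k (Fin 1 → ℤ))).coeff =
        Finsupp.single 1 1 - Finsupp.single 0 1 := rfl
    simp only [hcoeff, Finsupp.mapDomain_sub, Finsupp.mapDomain_single]
    rfl
  -- weights: `w·ez = 1`, `w·ex = 0`, `w·e0 = 0`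
  have hwz : dotWeight w ez = 1 := by
    rw [← hw, inductiveStep_leg_dotWeight, hez, Fin.append_right, Pi.single_eq_same]
  have hwx : dotWeight w ex = 0 := by
    rw [← hw, inductiveStep_leg_dotWeight, hex, Fin.append_right, Pi.zero_apply]
  have hw0 : dotWeight w e0 = 0 := by
    rw [← hw, inductiveStep_leg_dotWeight, he0, Fin.append_right, Pi.zero_apply]
  have hzx : ez ≠ ex := fun h => by
    have := congrFun h (Fin.natAdd 1 0)
    rw [hez, hex, Fin.append_right, Fin.append_right, Pi.single_eq_same] at this
    exact one_ne_zero this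
  have hz0 : ez ≠ e0 := fun h => by
    have := congrFun h (Fin.natAdd 1 0)
    rw [hez, he0, Fin.append_right, Fin.append_right, Pi.single_eq_same] at this
    exact one_ne_zero this
  have hx0 : ex ≠ e0 := fun h => by
    have := congrFun h (Fin.castAdd 1 0)
    rw [hex, he0, Fin.append_left, Fin.append_left] at this
    exact one_ne_zero this
  set g : AddMonoidAlgebra k (Fin (1 + 1) → ℤ) := single ez (1 : k) - (single ex (1 : k) - single e0 (1 : k)) with hg
  have hg_coeff : ∀ v, g.coeff v = (Finsupp.single ez (1 : k)) v - ((Finsupp.single ex (1 : k)) v -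
      (Finsupp.single e0 (1 : k)) v) := fun v => rfl
  clear_value g
  have hg_z : g.coeff ez = 1 := by
    rw [hg_coeff, Finsupp.single_eq_same, Finsupp.single_eq_of_ne hzx, Finsupp.single_eq_of_ne hz0]
    ring
  have hg_x : g.coeff ex = -1 := by
    rw [hg_coeff, Finsupp.single_eq_same, Finsupp.single_eq_of_ne hzx.symm, Finsupp.single_eq_of_ne hx0]
    ring
  have hg_0 : g.coeff e0 = 1 := by
    rw [hg_coeff, Finsupp.single_eq_same, Finsupp.single_eq_of_ne hz0.symm, Finsupp.single_eq_of_ne hx0.symm]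
    ring
  have hsupp : ∀ v ∈ g.coeff.support, v = ez ∨ v = ex ∨ v = e0 := by
    intro v hv
    by_contra hne
    push Not at hne
    rw [Finsupp.mem_support_iff, hg_coeff, Finsupp.single_eq_of_ne hne.1,
      Finsupp.single_eq_of_ne hne.2.1, Finsupp.single_eq_of_ne hne.2.2] at hv
    exact hv (by ring)
  have hx_supp : ex ∈ g.coeff.support := by
    rw [Finsupp.mem_support_iff, hg_x]
    exact neg_ne_zero.2 one_ne_zero
  have hmin : ∀ u ∈ g.coeff.support, (0 : ℤ) ≤ dotWeight w u := by
    intro u hu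
    rcases hsupp u hu with rfl | rfl | rfl
    · rw [hwz]; exact zero_le_one
    · rw [hwx]
    · rw [hw0]
  -- the initial form of `g` is `−(x − 1)`
  have hin : initialForm (dotWeight w) g = -(single ex (1 : k) - single e0 (1 : k)) := by
    apply AddMonoidAlgebra.coeff_injective
    ext v
    rw [coeff_initialForm_apply]
    change _ = -((Finsupp.single ex (1 : k)) v - (Finsupp.single e0 (1 : k)) v)
    by_cases hv : v ∈ g.coeff.support
    · rcases hsupp v hv with rfl | rfl | rfl
      · rw [if_neg, Finsupp.single_eq_of_ne hzx, Finsupp.single_eq_of_ne hz0]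
        · ring
        · intro hall
          have := hall ex hx_supp
          rw [hwz, hwx] at this
          exact absurd this (by norm_num)
      · rw [if_pos (fun u hu => by rw [hwx]; exact hmin u hu), hg_x, Finsupp.single_eq_same,
          Finsupp.single_eq_of_ne hx0]
        ring
      · rw [if_pos (fun u hu => by rw [hw0]; exact hmin u hu), hg_0, Finsupp.single_eq_of_ne hx0.symm,
          Finsupp.single_eq_same]
        ring
    · have hv0 : g.coeff v = 0 := Finsupp.notMem_support_iff.1 hv
      have hvz : v ≠ ex := fun h => hv (h ▸ hx_supp)
      have hv0' : v ≠ e0 := fun h => by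
        subst h
        rw [hg_0] at hv0
        exact one_ne_zero hv0
      rw [hv0, Finsupp.single_eq_of_ne hvz, Finsupp.single_eq_of_ne hv0']
      simp
  have hmem := initialForm_mem_initialIdeal (dotWeight w) hg_mem
  rw [hin] at hmem
  exact neg_mem_iff.1 hmem

end Summit.ResolutionOfSingularities.ResolutionOfSingularities.Theorems.InductiveStep.Negative
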